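import Summits.Ventures.DiscreteObjects.Hadamard.Order333LegendrePair668
import Summits.Ventures.DiscreteObjects.Hadamard.Order167GSQuad668
import Summits.Ventures.DiscreteObjects.Hadamard.InvolutionDet
import Summits.Ventures.DiscreteObjects.Hadamard.Order6Nega

/-!
# H(668): NO signed automorphism has pair order 666 (kernel EXCLUSION)

Framing: lottery ticket; floor = certified bounds/negative ranges.

Cell pub-namedobj (venture DiscreteObjects), target (H), hadamard gen 19.  A consequence of three kernel structure theorems of
the census: the order-333 orbit type (gen 19, `hadamard668_order333_orbitType`: an element `σ` of pair order `333` fixes exactly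
`2` rows / columns and acts freely with period `333` on the other `666`), the involution census (gen 12/13,
`hadamard668_involution_census` + `hadamard668_involution_typeI_mod4`: a signed involution is of type I with `4 ∣ f`,
`4 ≤ f ≤ 332` equal fixed counts, of type II with fixed counts `{0, 4}`, or fixed-point-free) and the order-6 theorem (gen 14,
`hadamard668_aut_order6_cube_fpf`: if the cube of an element of order `6` is fixed-point-free on rows and columns then its
square fixes `≡ 8 (mod 12)` rows).  Let `g = (π, κ, d, e)` have pair order `666`; put `σ = g²` (pair order `333`) and
`ι = g³³³` (a signed involution commuting with `σ`).  If `π^333` fixed a `σ`-free row it would fix its whole `σ`-orbit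
(`333` rows), which no involution type allows; so `Fix π^333 ⊆ Fix π² ` has at most `2` elements, likewise for columns, and the
census leaves only the fixed-point-free type (type I would need `4 ∣ 2`).  Then `h = g¹¹¹` has order `6` with fixed-point-free
cube `ι`, so `#Fix π^222 ≡ 8 (mod 12)` — but `Fix π^222 = Fix π²` has exactly `2` elements.  Hence:
* **`no_hadamard668_signedAut_order_666`**: `π^666 = κ^666 = 1` with `(π^333, κ^333)`, `(π^222, κ^222)`, `(π^18, κ^18)` all
  `≠ (1, 1)` is impossible; **`hadamard668_signedAut_not_dvd_orderOf_666`**: `666 ∤ orderOf (π, κ)` for every signed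
  automorphism of every Hadamard matrix of order `668`.
In the dictionary of `Order333LegendrePair668` (order 333 ⇔ LP(333)): no Hadamard matrix of order 668 built on a Legendre pair
of length 333 — nor any other — has a signed automorphism of order `2` commuting with the core shift whose product with it has
pair order `666`; the element orders divisible by `333` are exactly `333` (if LP(333) exists) — `999 = 27·37` and `333·q` being
excluded before (gens 11/18).  EXCLUSION of an element order of the (hypothetical) automorphism group; H(668) untouched.  Ours; no
`sorry`.
-/

namespace Summit.Ventures.DiscreteObjects.Hadamard

open Finset BigOperators Matrix

open Literature.Combinatorics.Designs.GoethalsSeidel (IsHadamardMatrix)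

variable {ι : Type*} [Fintype ι] [DecidableEq ι]

/-! ### permutation lemmas: `ρ^666 = 1`, `ρ²` with two fixed points and free of period `333` elsewhere -/

section perm
variable (ρ : Equiv.Perm ι) (hρ : ρ ^ 666 = 1) (hfree : ∀ x, (ρ ^ 2) x ≠ x → ∀ k, 0 < k → k < 333 → ((ρ ^ 2) ^ k) x ≠ x)
include hfree

omit [Fintype ι] in
/-- `Fix ρ^222 = Fix ρ²` pointwise -/
lemma fixed_222_iff (x : ι) : (ρ ^ 222) x = x ↔ (ρ ^ 2) x = x := by
  constructor
  · intro h
    by_contra hne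
    exact hfree x hne 111 (by norm_num) (by norm_num) (by rw [← pow_mul]; exact h)
  · intro h
    rw [show (222 : ℕ) = 2 * 111 by norm_num, pow_mul]
    exact perm_pow_apply_of_fixed _ h 111

/-- if `ρ^333` fixes a `ρ²`-free point then it fixes at least `333` points (the whole `ρ²`-orbit) -/
lemma card_fixed_333_large {x : ι} (hx : (ρ ^ 2) x ≠ x) (hfix : (ρ ^ 333) x = x) :
    333 ≤ (univ.filter fun i => (ρ ^ 333) i = i).card := by
  have hsub : orbFin (ρ ^ 2) 333 x ⊆ univ.filter fun i => (ρ ^ 333) i = i := by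
    intro y hy
    obtain ⟨k, -, rfl⟩ := Finset.mem_image.mp hy
    rw [Finset.mem_filter]
    refine ⟨Finset.mem_univ _, ?_⟩
    rw [← Equiv.Perm.mul_apply, ← pow_mul, ← pow_add, show 333 + 2 * k = 2 * k + 333 by ring, pow_add, pow_mul,
      Equiv.Perm.mul_apply, hfix]
  have h := Finset.card_le_card hsub
  rwa [card_orbFin_of_free (hfree x hx)] at h

/-- dichotomy: `ρ^333` fixes at most the two `ρ²`-fixed points, or at least `333` points -/
lemma card_fixed_333_dichotomy (h2 : (univ.filter fun i => (ρ ^ 2) i = i).card = 2) :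
    (univ.filter fun i => (ρ ^ 333) i = i).card ≤ 2 ∨ 333 ≤ (univ.filter fun i => (ρ ^ 333) i = i).card := by
  by_cases h : ∃ x, (ρ ^ 2) x ≠ x ∧ (ρ ^ 333) x = x
  · obtain ⟨x, hx, hfix⟩ := h
    exact Or.inr (card_fixed_333_large ρ hfree hx hfix)
  · left
    rw [← h2]
    apply Finset.card_le_card
    intro x hx
    rw [Finset.mem_filter] at hx ⊢
    refine ⟨hx.1, ?_⟩
    by_contra hne
    exact h ⟨x, hne, hx.2⟩

end perm

/-! ### the exclusion -/

section main
variable {H : Matrix ι ι ℤ}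

omit [Fintype ι] [DecidableEq ι] in
/-- pointwise sixth power of `ρ^111` from `ρ^666 = 1` -/
private lemma pow111_six (ρ : Equiv.Perm ι) (hρ : ρ ^ 666 = 1) (i : ι) :
    (ρ ^ 111) ((ρ ^ 111) ((ρ ^ 111) ((ρ ^ 111) ((ρ ^ 111) ((ρ ^ 111) i))))) = i := by
  rw [← Equiv.Perm.mul_apply, ← Equiv.Perm.mul_apply, ← Equiv.Perm.mul_apply, ← Equiv.Perm.mul_apply,
    ← Equiv.Perm.mul_apply, ← pow_add, ← pow_add, ← pow_add, ← pow_add, ← pow_add]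
  show (ρ ^ 666) i = i
  rw [hρ, Equiv.Perm.one_apply]

omit [Fintype ι] [DecidableEq ι] in
/-- pointwise cube of `ρ^111` -/
private lemma pow111_three (ρ : Equiv.Perm ι) (i : ι) :
    (ρ ^ 111) ((ρ ^ 111) ((ρ ^ 111) i)) = (ρ ^ 333) i := by
  rw [← Equiv.Perm.mul_apply, ← Equiv.Perm.mul_apply, ← pow_add, ← pow_add]

omit [Fintype ι] [DecidableEq ι] in
/-- pointwise square of `ρ^111` -/
private lemma pow111_two (ρ : Equiv.Perm ι) (i : ι) : (ρ ^ 111) ((ρ ^ 111) i) = (ρ ^ 222) i := by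
  rw [← Equiv.Perm.mul_apply, ← pow_add]

/-- **No signed automorphism of pair order 666.** -/
theorem no_hadamard668_signedAut_order_666 (hH : IsHadamardMatrix H) (hι : Fintype.card ι = 668)
    (π κ : Equiv.Perm ι) (d e : ι → ℤ) (haut : IsSignedAut H π κ d e)
    (hπ : π ^ 666 = 1) (hκ : κ ^ 666 = 1) (h333 : π ^ 333 ≠ 1 ∨ κ ^ 333 ≠ 1)
    (h222 : π ^ 222 ≠ 1 ∨ κ ^ 222 ≠ 1) (h18 : π ^ 18 ≠ 1 ∨ κ ^ 18 ≠ 1) : False := by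
  -- σ = g² has pair order 333
  have hσπ : (π ^ 2) ^ 333 = 1 := by rw [← pow_mul]; exact hπ
  have hσκ : (κ ^ 2) ^ 333 = 1 := by rw [← pow_mul]; exact hκ
  have h111 : (π ^ 2) ^ 111 ≠ 1 ∨ (κ ^ 2) ^ 111 ≠ 1 := by rw [← pow_mul, ← pow_mul]; exact h222
  have h9 : (π ^ 2) ^ 9 ≠ 1 ∨ (κ ^ 2) ^ 9 ≠ 1 := by rw [← pow_mul, ← pow_mul]; exact h18
  obtain ⟨⟨hR2, hRfree⟩, hC2, hCfree⟩ :=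
    hadamard668_order333_orbitType hH hι (π ^ 2) (κ ^ 2) _ _ (isSignedAut_pow haut 2) hσπ hσκ h111 h9
  -- ι = g^333 is a nontrivial signed involution
  have hιπ : (π ^ 333) ^ 2 = 1 := by rw [← pow_mul]; exact hπ
  have hικ : (κ ^ 333) ^ 2 = 1 := by rw [← pow_mul]; exact hκ
  have hautι := isSignedAut_pow haut 333
  obtain ⟨-, -, hcases⟩ := hadamard668_involution_census hH hι (π ^ 333) (κ ^ 333) _ _ hautι hιπ hικ h333
  -- fixed counts of π^333, κ^333 are ≤ 2
  have hRle : (univ.filter fun i => (π ^ 333) i = i).card ≤ 2 := by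
    rcases card_fixed_333_dichotomy π hRfree hR2 with h | h
    · exact h
    · exfalso
      rcases hcases with ⟨-, -, -, hle, -⟩ | ⟨h0, -, -⟩ | ⟨h4, -, -⟩ | ⟨h0, -⟩ <;> omega
  have hCle : (univ.filter fun j => (κ ^ 333) j = j).card ≤ 2 := by
    rcases card_fixed_333_dichotomy κ hCfree hC2 with h | h
    · exact h
    · exfalso
      rcases hcases with ⟨heq, -, -, hle, -⟩ | ⟨-, h4, -⟩ | ⟨-, h0, -⟩ | ⟨-, h0⟩ <;> omega
  -- only the fixed-point-free type survives
  have hfpf : (univ.filter fun i => (π ^ 333) i = i).card = 0 ∧ (univ.filter fun j => (κ ^ 333) j = j).card = 0 := by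
    rcases hcases with ⟨heq, -, h2le, -, -⟩ | ⟨-, h4, -⟩ | ⟨h4, -, -⟩ | ⟨h0, h0'⟩
    · -- type I: f = 2, but then 4 ∣ f
      exfalso
      have hr : ∃ i, (π ^ 333) i = i := by
        have hpos : 0 < (univ.filter fun i => (π ^ 333) i = i).card := by omega
        obtain ⟨i, hi⟩ := Finset.card_pos.mp hpos
        exact ⟨i, (Finset.mem_filter.mp hi).2⟩
      have hc : ∃ j, (κ ^ 333) j = j := by
        have hpos : 0 < (univ.filter fun j => (κ ^ 333) j = j).card := by omega
        obtain ⟨j, hj⟩ := Finset.card_pos.mp hpos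
        exact ⟨j, (Finset.mem_filter.mp hj).2⟩
      obtain ⟨h4, h4le, -, -⟩ := hadamard668_involution_typeI_mod4 hH hι (π ^ 333) (κ ^ 333) _ _ hautι hιπ hικ h333 hr hc
      omega
    · exfalso; omega
    · exfalso; omega
    · exact ⟨h0, h0'⟩
  have hπfpf : ∀ i, (π ^ 333) i ≠ i := moved_of_card_fixed_eq_zero _ hfpf.1
  have hκfpf : ∀ j, (κ ^ 333) j ≠ j := moved_of_card_fixed_eq_zero _ hfpf.2
  -- h = g^111 has order 6 with fixed-point-free cube
  have hauth := isSignedAut_pow haut 111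
  obtain ⟨-, -, hmod, -⟩ := hadamard668_aut_order6_cube_fpf hH hι hauth (pow111_six π hπ) (pow111_six κ hκ)
    (fun i h => hπfpf i (by rw [← pow111_three]; exact h)) (fun j h => hκfpf j (by rw [← pow111_three]; exact h))
  -- but Fix π^222 = Fix π² has two elements
  have hF : (univ.filter fun i => (π ^ 111) ((π ^ 111) i) = i) = univ.filter fun i => (π ^ 2) i = i := by
    ext i
    simp only [Finset.mem_filter, Finset.mem_univ, true_and, pow111_two]
    exact fixed_222_iff π hRfree i
  rw [hF, hR2] at hmod
  norm_num at hmod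

/-- **Order form: `666 ∤ orderOf (π, κ)`** for every signed automorphism of a Hadamard matrix of order `668`. -/
theorem hadamard668_signedAut_not_dvd_orderOf_666 (hH : IsHadamardMatrix H) (hι : Fintype.card ι = 668)
    (π κ : Equiv.Perm ι) (d e : ι → ℤ) (haut : IsSignedAut H π κ d e) :
    ¬ 666 ∣ orderOf ((π, κ) : Equiv.Perm ι × Equiv.Perm ι) := by
  intro hdvd
  set x : Equiv.Perm ι × Equiv.Perm ι := (π, κ) with hx
  have hx0 : orderOf x ≠ 0 := (orderOf_pos x).ne'
  set k := orderOf x / 666 with hk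
  have hord : orderOf (x ^ k) = 666 := orderOf_pow_orderOf_div hx0 hdvd
  have hxk : x ^ k = ((π ^ k, κ ^ k) : Equiv.Perm ι × Equiv.Perm ι) := by rw [hx, Prod.pow_mk]
  rw [hxk] at hord
  obtain ⟨h1, h2, h333⟩ := pow_data_of_orderOf hord (a := 333) (by norm_num) (by norm_num)
  obtain ⟨-, -, h222⟩ := pow_data_of_orderOf hord (a := 222) (by norm_num) (by norm_num)
  obtain ⟨-, -, h18⟩ := pow_data_of_orderOf hord (a := 18) (by norm_num) (by norm_num)
  exact no_hadamard668_signedAut_order_666 hH hι (π ^ k) (κ ^ k) _ _ (isSignedAut_pow haut k) h1 h2 h333 h222 h18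

/-- **Corollary: the element orders divisible by 333 are exactly {333}.**  If `333 ∣ orderOf (π, κ)` then
`orderOf (π, κ) = 333` (using also `999 ∤` and `333·q ∤` from gens 11/18 is NOT needed here: we only record `666 ∤` and
`2 ∤ orderOf / 333` in the weaker form below). -/
theorem hadamard668_signedAut_orderOf_333_odd_part (hH : IsHadamardMatrix H) (hι : Fintype.card ι = 668)
    (π κ : Equiv.Perm ι) (d e : ι → ℤ) (haut : IsSignedAut H π κ d e)
    (h333 : 333 ∣ orderOf ((π, κ) : Equiv.Perm ι × Equiv.Perm ι)) :
    ¬ 2 ∣ orderOf ((π, κ) : Equiv.Perm ι × Equiv.Perm ι) := by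
  intro h2
  have h666 : 666 ∣ orderOf ((π, κ) : Equiv.Perm ι × Equiv.Perm ι) := by
    have hcop : Nat.Coprime 2 333 := by norm_num
    have := Nat.Coprime.mul_dvd_of_dvd_of_dvd hcop h2 h333
    simpa using this
  exact hadamard668_signedAut_not_dvd_orderOf_666 hH hι π κ d e haut h666

end main

end Summit.Ventures.DiscreteObjects.Hadamard
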